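import Summits.AtomisticToContinuum.HydrodynamicLimit.Theorems.RelayRaceLocalityConeLocalisationBubbleZoom
import HarnessLib

/-!
# The hyperbolic zoom of compactly supported bubbles on `𝕋³`, II: covariance of the Euler system

Helper file for the stub `stub_bubble : BubbleAtScale` of the line `Sketch` of the crux
`ConeLocalisation` (stmt-AtomisticToContinuum-12504, route `RelayRaceLocality`); continuation of
`RelayRaceLocalityConeLocalisationBubbleZoom.lean` (the zoom map `zoomPt x₀ m`, its minimal-image
geometry, local structure and the junk-free chain rule for `Torus.partialDeriv`).

* iterated words: `partialDeriv₂_zoom`, `partialDeriv₃_zoom` (factors `m⁻²`, `m⁻³`, junk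
  included; the radius is enlarged between steps, `partialDeriv_eq_zero_of_far`);
* `gradient_zoom`, `divergence_zoom` — `∇` and `div` of zoomed fields (factor `m⁻¹`, junk
  included: Mathlib `fderiv_comp_smul` is unconditional);
* `timeDerivWithin_comp_div`, `isSmoothSpaceTimeOn_comp_div` — the time dilation `s ↦ s/m` on
  `[0, mT)` (junk-free: Mathlib `derivWithin_comp_mul_left` and `m⁻¹ • [0, mT) = [0, T)`);
* **(Z1)** `isHardSphereEulerSolution_zoom` / `hsEuler_zoom`: if `(ρ, u, θ)` is a classical
  hard-sphere Euler solution on `[0, T)` (`IsHardSphereEulerSolution σ T ρ u θ`) whose slices equal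
  a constant state `(ρ̄, ū, θ̄)` outside `{d(·, x₀) < a}`, `m > 1`, `m a < 1/4`, then
  `(s, y) ↦ (ρ, u, θ)(s/m, zoomPt x₀ m y)` is a classical solution on `[0, mT)` for the SAME
  reduced diameter `σ` (the pressure law `p = ρθZ(ρσ³)` is untouched: every term of each
  conservation law at `(s, y)` is `m⁻¹` times the corresponding term at `(s/m, zoomPt x₀ m y)`;
  no regularity of the pressure slice is needed since the chain rules are junk-free), and its
  slices equal the constant state outside `{d(·, x₀) < m a}`.

References: R. Courant, K. O. Friedrichs, *Supersonic Flow and Shock Waves* (1948), §17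
(similarity of gas flows under `(t, x) ↦ (λt, λx)`); H. Spohn, *Large Scale Dynamics of
Interacting Particles* (1991), Part I Ch. 3 (the hard-sphere Euler system).
-/

noncomputable section

open scoped Topology Pointwise ContDiff
open Filter Set Metric
open Literature.MathematicalPhysics.KineticTheory Literature.Analysis.FluidPDE
  Literature.Analysis.FunctionSpaces

namespace Summit.AtomisticToContinuum.HydrodynamicLimit.Theorems.ConeLocalisation.Bubble

section Calculus

variable {X : Type*} [NormedAddCommGroup X] [NormedSpace ℝ X]
variable {m a : ℝ} {x₀ : T3}

/-! ## Iterated partial derivatives of zoomed fields -/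

/-- Constant factors pass through `Torus.partialDeriv` unconditionally (junk included). -/
theorem partialDeriv_const_smul_fun (r : ℝ) (G : T3 → X) (i : Fin 3) :
    Torus.partialDeriv i (fun y => r • G y) = fun y => r • Torus.partialDeriv i G y := by
  funext y
  unfold Torus.partialDeriv Torus.lineDeriv
  exact deriv_fun_const_smul_field r _

/-- A radius strictly between `a` and `1/(4m)`. -/
theorem exists_radius_between (hm : 0 < m) (hma : m * a < 1 / 4) :
    ∃ a', a < a' ∧ m * a' < 1 / 4 := by
  have h1 := lt_one_div_four_mul hm hma
  have : m * (1 / (4 * m)) = 1 / 4 := by field_simp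
  exact ⟨(a + 1 / (4 * m)) / 2, by linarith, by nlinarith⟩

/-- **(Z2), words of length 2**: `∂ᵢ∂ⱼ(F ∘ zoomPt x₀ m)(y) = m⁻² • (∂ᵢ∂ⱼF)(zoomPt x₀ m y)`,
junk values included (`∂ⱼF` vanishes outside every ball `{d(·,x₀) < a'}`, `a' > a`). -/
theorem partialDeriv₂_zoom (hm : 1 < m) (hma : m * a < 1 / 4) {F : T3 → X} {c : X}
    (hF : ∀ x, a ≤ Torus.euclidDist x x₀ → F x = c) (i j : Fin 3) (y : T3) :
    Torus.partialDeriv i (Torus.partialDeriv j fun y => F (zoomPt x₀ m y)) y =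
      m⁻¹ ^ 2 • Torus.partialDeriv i (Torus.partialDeriv j F) (zoomPt x₀ m y) := by
  obtain ⟨a', ha', hma'⟩ := exists_radius_between (zero_lt_one.trans hm) hma
  have hF' : ∀ x, a' ≤ Torus.euclidDist x x₀ → Torus.partialDeriv j F x = 0 := fun x hx =>
    partialDeriv_eq_zero_of_far hF j (ha'.trans_le hx)
  rw [partialDeriv_zoom' hm hma hF j, partialDeriv_const_smul_fun]
  beta_reduce
  rw [partialDeriv_zoom hm hma' hF' i y, smul_smul, sq]

/-- **(Z2), words of length 3**: `∂ᵢ∂ⱼ∂ₖ(F ∘ zoomPt x₀ m)(y) = m⁻³ • (∂ᵢ∂ⱼ∂ₖF)(zoomPt x₀ m y)`,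
junk values included. -/
theorem partialDeriv₃_zoom (hm : 1 < m) (hma : m * a < 1 / 4) {F : T3 → X} {c : X}
    (hF : ∀ x, a ≤ Torus.euclidDist x x₀ → F x = c) (i j k : Fin 3) (y : T3) :
    Torus.partialDeriv i (Torus.partialDeriv j (Torus.partialDeriv k fun y => F (zoomPt x₀ m y))) y =
      m⁻¹ ^ 3 • Torus.partialDeriv i (Torus.partialDeriv j (Torus.partialDeriv k F))
        (zoomPt x₀ m y) := by
  obtain ⟨a', ha', hma'⟩ := exists_radius_between (zero_lt_one.trans hm) hma
  have hF' : ∀ x, a' ≤ Torus.euclidDist x x₀ → Torus.partialDeriv k F x = 0 := fun x hx =>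
    partialDeriv_eq_zero_of_far hF k (ha'.trans_le hx)
  rw [partialDeriv_zoom' hm hma hF k, partialDeriv_const_smul_fun, partialDeriv_const_smul_fun]
  beta_reduce
  rw [partialDeriv₂_zoom hm hma' hF' i j y, smul_smul]
  congr 1
  ring

/-- **(Z2) Gradient of the zoomed field**, junk values included:
`∇(F ∘ zoomPt x₀ m)(y) = m⁻¹ • (∇F)(zoomPt x₀ m y)`. -/
theorem gradient_zoom (hm : 1 < m) (hma : m * a < 1 / 4) {F : T3 → ℝ} {c : ℝ}
    (hF : ∀ x, a ≤ Torus.euclidDist x x₀ → F x = c) (y : T3) :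
    Torus.gradient (fun y => F (zoomPt x₀ m y)) y = m⁻¹ • Torus.gradient F (zoomPt x₀ m y) := by
  unfold Torus.gradient
  rcases liftAt_zoom_local hm hma hF y with h | ⟨h1, h2⟩
  · rw [h.gradient_eq]
    unfold gradient
    rw [show (fun v => Torus.liftAt F (zoomPt x₀ m y) (m⁻¹ • v)) =
        (Torus.liftAt F (zoomPt x₀ m y) <| m⁻¹ • ·) from rfl, fderiv_comp_smul, smul_zero,
      map_smulₛₗ, starRingEnd_apply, star_trivial]
  · rw [h1.gradient_eq, h2.gradient_eq, gradient_fun_const, smul_zero]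

/-- **(Z2) Divergence of a zoomed vector field**, junk values included:
`div(G ∘ zoomPt x₀ m)(y) = m⁻¹ div G (zoomPt x₀ m y)`. -/
theorem divergence_zoom (hm : 1 < m) (hma : m * a < 1 / 4) {G : T3 → V3} {c : V3}
    (hG : ∀ x, a ≤ Torus.euclidDist x x₀ → G x = c) (y : T3) :
    Torus.divergence (fun y => G (zoomPt x₀ m y)) y = m⁻¹ * Torus.divergence G (zoomPt x₀ m y) := by
  unfold Torus.divergence
  rw [Finset.mul_sum]
  refine Finset.sum_congr rfl fun i _ => ?_
  have h := partialDeriv_zoom (x₀ := x₀) hm hma (F := fun x => G x i) (c := c i)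
    (fun x hx => by simp only [hG x hx]) i y
  simpa only [smul_eq_mul] using h

/-- Slices of time-dependent fields: `∂ᵢ(φ t ∘ zoomPt x₀ m)(y) = m⁻¹ • ∂ᵢ(φ t)(zoomPt x₀ m y)`
(use with `t = s/m` for the zoomed solution `(s, y) ↦ φ (s/m) (zoomPt x₀ m y)`). -/
theorem partialDeriv_zoom_slice {S : Set ℝ} {φ : ℝ → T3 → X} {c : X} (hm : 1 < m)
    (hma : m * a < 1 / 4) (hφ : ∀ t ∈ S, ∀ x, a ≤ Torus.euclidDist x x₀ → φ t x = c) {t : ℝ}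
    (ht : t ∈ S) (i : Fin 3) (y : T3) :
    Torus.partialDeriv i (fun y => φ t (zoomPt x₀ m y)) y =
      m⁻¹ • Torus.partialDeriv i (φ t) (zoomPt x₀ m y) :=
  partialDeriv_zoom hm hma (hφ t ht) i y

/-! ## Reading bounds on a field off its zoom (the zoom covers the small cube, the rest is constant) -/

/-- Every point of `𝕋³` is either a zoomed point (with the distance to `x₀` multiplied by `m`) or
lies at distance `> a` from `x₀`, when `m > 1` and `m a < 1/4`. -/
theorem zoom_cover (hm : 1 < m) (hma : m * a < 1 / 4) (x : T3) :
    (∃ y, zoomPt x₀ m y = x ∧ Torus.euclidDist y x₀ = m * Torus.euclidDist x x₀) ∨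
      a < Torus.euclidDist x x₀ := by
  have h0 : 0 < m := zero_lt_one.trans hm
  rcases lt_or_ge (Torus.euclidDist x x₀) (1 / (2 * m)) with hx | hx
  · exact Or.inl ⟨_, zoomPt_unzoom h0 hx, euclidDist_unzoom h0 hx⟩
  · refine Or.inr ((lt_one_div_four_mul h0 hma).trans_le (le_trans ?_ hx))
    gcongr
    norm_num

/-- The partial derivatives of `F` at a zoomed point, read off the zoomed field:
`(∂ᵢF)(zoomPt x₀ m y) = m • ∂ᵢ(F ∘ zoomPt x₀ m)(y)`. -/
theorem partialDeriv_at_zoomPt (hm : 1 < m) (hma : m * a < 1 / 4) {F : T3 → X} {c : X}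
    (hF : ∀ x, a ≤ Torus.euclidDist x x₀ → F x = c) (i : Fin 3) (y : T3) :
    Torus.partialDeriv i F (zoomPt x₀ m y) =
      m • Torus.partialDeriv i (fun y => F (zoomPt x₀ m y)) y := by
  rw [partialDeriv_zoom hm hma hF i y, smul_smul, mul_inv_cancel₀ (zero_lt_one.trans hm).ne',
    one_smul]

/-- **Sup bounds transfer back through the zoom**: a uniform bound `B ≥ 0` on `∂ᵢ(F ∘ zoomPt x₀ m)`
gives the bound `m B` on `∂ᵢF` everywhere (outside the covered cube `∂ᵢF = 0`). -/
theorem norm_partialDeriv_le_of_zoom (hm : 1 < m) (hma : m * a < 1 / 4) {F : T3 → X} {c : X}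
    (hF : ∀ x, a ≤ Torus.euclidDist x x₀ → F x = c) (i : Fin 3) {B : ℝ} (hB0 : 0 ≤ B)
    (hB : ∀ y, ‖Torus.partialDeriv i (fun y => F (zoomPt x₀ m y)) y‖ ≤ B) (x : T3) :
    ‖Torus.partialDeriv i F x‖ ≤ m * B := by
  have h0 : 0 < m := zero_lt_one.trans hm
  rcases zoom_cover (x₀ := x₀) hm hma x with ⟨y, rfl, -⟩ | hx
  · rw [partialDeriv_at_zoomPt hm hma hF i y, norm_smul, Real.norm_eq_abs, abs_of_pos h0]
    exact mul_le_mul_of_nonneg_left (hB y) h0.le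
  · rw [partialDeriv_eq_zero_of_far hF i hx, norm_zero]
    positivity

omit [NormedSpace ℝ X] in
/-- Values transfer trivially: a uniform bound on `‖F ∘ zoomPt x₀ m - c‖` bounds `‖F - c‖`. -/
theorem norm_sub_le_of_zoom (hm : 1 < m) (hma : m * a < 1 / 4) {F : T3 → X} {c : X}
    (hF : ∀ x, a ≤ Torus.euclidDist x x₀ → F x = c) {B : ℝ} (hB0 : 0 ≤ B)
    (hB : ∀ y, ‖F (zoomPt x₀ m y) - c‖ ≤ B) (x : T3) : ‖F x - c‖ ≤ B := by
  rcases zoom_cover (x₀ := x₀) hm hma x with ⟨y, rfl, -⟩ | hx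
  · exact hB y
  · rw [hF x hx.le, sub_self, norm_zero]
    exact hB0

/-! ## The time dilation `s ↦ s / m` on `[0, mT)` -/

/-- `s ↦ s / m` maps `[0, mT)` into `[0, T)` (`m > 0`). -/
theorem div_mem_Ico {T s : ℝ} (hm : 0 < m) (hs : s ∈ Ico 0 (m * T)) : s / m ∈ Ico 0 T :=
  ⟨div_nonneg hs.1 hm.le, by rw [div_lt_iff₀ hm, mul_comm]; exact hs.2⟩

/-- **(Z2) The one-sided time derivative under the dilation `s ↦ s/m`**, junk values included
(Mathlib `derivWithin_comp_mul_left`, `m⁻¹ • [0, mT) = [0, T)`):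
`∂ₛ|_{[0,mT)} φ(s/m, x) = m⁻¹ • (∂ₜ|_{[0,T)} φ)(s/m, x)`. -/
theorem timeDerivWithin_comp_div (φ : ℝ → T3 → X) (hm : 0 < m) (T s : ℝ) (x : T3) :
    Torus.timeDerivWithin (Ico 0 (m * T)) (fun τ y => φ (τ / m) y) s x =
      m⁻¹ • Torus.timeDerivWithin (Ico 0 T) φ (s / m) x := by
  unfold Torus.timeDerivWithin
  have e : (fun τ => φ (τ / m) x) = fun τ => (fun τ' => φ τ' x) (m⁻¹ * τ) := by
    funext τ; rw [div_eq_inv_mul]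
  rw [e, derivWithin_comp_mul_left m⁻¹ (fun τ' => φ τ' x) (Ico 0 (m * T)) s,
    LinearOrderedField.smul_Ico (inv_pos.2 hm), mul_zero, inv_mul_cancel_left₀ hm.ne',
    div_eq_inv_mul]

/-- Joint smoothness under the time dilation `s ↦ s/m`. -/
theorem isSmoothSpaceTimeOn_comp_div {T : ℝ} {φ : ℝ → T3 → X}
    (hφ : Torus.IsSmoothSpaceTimeOn (Ico 0 T) φ) (hm : 0 < m) :
    Torus.IsSmoothSpaceTimeOn (Ico 0 (m * T)) (fun τ y => φ (τ / m) y) := by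
  unfold Torus.IsSmoothSpaceTimeOn at hφ ⊢
  have e : Torus.stLift (fun τ y => φ (τ / m) y) =
      Torus.stLift φ ∘ fun p : ℝ × V3 => (p.1 / m, p.2) := by
    funext p; rfl
  rw [e]
  refine hφ.comp (by fun_prop) ?_
  intro p hp
  exact mk_mem_prod (div_mem_Ico hm (mem_prod.1 hp).1) (mem_univ _)

end Calculus

/-! ## (Z1) Covariance of the hard-sphere Euler system under the hyperbolic zoom -/

section Euler

variable {σ T : ℝ} {ρ θ : ℝ → T3 → ℝ} {u : ℝ → T3 → V3} {m a : ℝ} {x₀ : T3}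
  {ρbar θbar : ℝ} {ubar : V3}

/-- **(Z1) Hyperbolic zoom covariance of compactly supported bubbles.** If `(ρ, u, θ)` is a
classical hard-sphere Euler solution on `[0, T)` at reduced diameter `σ` whose slices equal the
constant state `(ρ̄, θ̄, ū)` outside `{d(·, x₀) < a}`, and `m > 1`, `m a < 1/4`, then the zoomed
triple `(s, y) ↦ (ρ, u, θ)(s/m, zoomPt x₀ m y)` is a classical hard-sphere Euler solution on
`[0, mT)` at the same `σ`. -/
theorem isHardSphereEulerSolution_zoom (hE : IsHardSphereEulerSolution σ T ρ u θ) (hm : 1 < m)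
    (hma : m * a < 1 / 4)
    (hsupp : ∀ t ∈ Ico 0 T, ∀ x, a ≤ Torus.euclidDist x x₀ →
      ρ t x = ρbar ∧ θ t x = θbar ∧ u t x = ubar) :
    IsHardSphereEulerSolution σ (m * T) (fun s y => ρ (s / m) (zoomPt x₀ m y))
      (fun s y => u (s / m) (zoomPt x₀ m y)) (fun s y => θ (s / m) (zoomPt x₀ m y)) := by
  have h0 : 0 < m := zero_lt_one.trans hm
  have hρ : ∀ t ∈ Ico 0 T, ∀ x, a ≤ Torus.euclidDist x x₀ → ρ t x = ρbar :=
    fun t ht x hx => (hsupp t ht x hx).1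
  have hθ : ∀ t ∈ Ico 0 T, ∀ x, a ≤ Torus.euclidDist x x₀ → θ t x = θbar :=
    fun t ht x hx => (hsupp t ht x hx).2.1
  have hu : ∀ t ∈ Ico 0 T, ∀ x, a ≤ Torus.euclidDist x x₀ → u t x = ubar :=
    fun t ht x hx => (hsupp t ht x hx).2.2
  refine ⟨?_, ?_, ?_, fun s hs y => hE.density_pos _ (div_mem_Ico h0 hs) _,
    fun s hs y => hE.temperature_pos _ (div_mem_Ico h0 hs) _, fun s hs y => ?_, fun s hs y => ?_,
    fun s hs y => ?_⟩
  · exact isSmoothSpaceTimeOn_comp_div (isSmoothSpaceTimeOn_zoom hE.smooth_density hm hma.le hρ) h0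
  · exact isSmoothSpaceTimeOn_comp_div (isSmoothSpaceTimeOn_zoom hE.smooth_velocity hm hma.le hu) h0
  · exact isSmoothSpaceTimeOn_comp_div
      (isSmoothSpaceTimeOn_zoom hE.smooth_temperature hm hma.le hθ) h0
  · -- mass: `m⁻¹ (∂ₜρ + div(ρu))(s/m, zoomPt y) = 0`
    have ht := div_mem_Ico h0 hs
    have e1 : Torus.timeDerivWithin (Ico 0 (m * T)) (fun s y => ρ (s / m) (zoomPt x₀ m y)) s y =
        m⁻¹ • Torus.timeDerivWithin (Ico 0 T) ρ (s / m) (zoomPt x₀ m y) :=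
      timeDerivWithin_comp_div (fun t y => ρ t (zoomPt x₀ m y)) h0 T s y
    have e2 : Torus.divergence
        (fun y => ρ (s / m) (zoomPt x₀ m y) • u (s / m) (zoomPt x₀ m y)) y =
        m⁻¹ * Torus.divergence (fun x => ρ (s / m) x • u (s / m) x) (zoomPt x₀ m y) :=
      divergence_zoom hm hma (G := fun x => ρ (s / m) x • u (s / m) x) (c := ρbar • ubar)
        (fun x hx => by rw [hρ _ ht x hx, hu _ ht x hx]) y
    rw [e1, e2, smul_eq_mul, ← mul_add, hE.mass _ ht _, mul_zero]
  · -- momentum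
    have ht := div_mem_Ico h0 hs
    have e1 : Torus.timeDerivWithin (Ico 0 (m * T))
        (fun s y => ρ (s / m) (zoomPt x₀ m y) • u (s / m) (zoomPt x₀ m y)) s y =
        m⁻¹ • Torus.timeDerivWithin (Ico 0 T) (fun s y => ρ s y • u s y) (s / m)
          (zoomPt x₀ m y) :=
      timeDerivWithin_comp_div (fun t y => ρ t (zoomPt x₀ m y) • u t (zoomPt x₀ m y)) h0 T s y
    have e2 : ∀ i : Fin 3, Torus.partialDeriv i
        (fun y => (ρ (s / m) (zoomPt x₀ m y) * u (s / m) (zoomPt x₀ m y) i) •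
          u (s / m) (zoomPt x₀ m y)) y =
        m⁻¹ • Torus.partialDeriv i (fun x => (ρ (s / m) x * u (s / m) x i) • u (s / m) x)
          (zoomPt x₀ m y) := fun i =>
      partialDeriv_zoom hm hma (F := fun x => (ρ (s / m) x * u (s / m) x i) • u (s / m) x)
        (c := (ρbar * ubar i) • ubar) (fun x hx => by rw [hρ _ ht x hx, hu _ ht x hx]) i y
    have e3 : Torus.gradient
        (fun y => hsPressure σ (ρ (s / m) (zoomPt x₀ m y)) (θ (s / m) (zoomPt x₀ m y))) y =
        m⁻¹ • Torus.gradient (fun x => hsPressure σ (ρ (s / m) x) (θ (s / m) x))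
          (zoomPt x₀ m y) :=
      gradient_zoom hm hma (F := fun x => hsPressure σ (ρ (s / m) x) (θ (s / m) x))
        (c := hsPressure σ ρbar θbar) (fun x hx => by rw [hρ _ ht x hx, hθ _ ht x hx]) y
    rw [e1, Finset.sum_congr rfl fun i _ => e2 i, e3, ← Finset.smul_sum, ← smul_add, ← smul_add,
      hE.momentum _ ht _, smul_zero]
  · -- energy
    have ht := div_mem_Ico h0 hs
    have e1 : Torus.timeDerivWithin (Ico 0 (m * T))
        (fun s y => totalEnergyDensity (ρ (s / m) (zoomPt x₀ m y)) (u (s / m) (zoomPt x₀ m y))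
          (θ (s / m) (zoomPt x₀ m y))) s y =
        m⁻¹ • Torus.timeDerivWithin (Ico 0 T)
          (fun s y => totalEnergyDensity (ρ s y) (u s y) (θ s y)) (s / m) (zoomPt x₀ m y) :=
      timeDerivWithin_comp_div (fun t y => totalEnergyDensity (ρ t (zoomPt x₀ m y))
        (u t (zoomPt x₀ m y)) (θ t (zoomPt x₀ m y))) h0 T s y
    have e2 : Torus.divergence (fun y =>
        (totalEnergyDensity (ρ (s / m) (zoomPt x₀ m y)) (u (s / m) (zoomPt x₀ m y))
            (θ (s / m) (zoomPt x₀ m y)) +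
          hsPressure σ (ρ (s / m) (zoomPt x₀ m y)) (θ (s / m) (zoomPt x₀ m y))) •
          u (s / m) (zoomPt x₀ m y)) y =
        m⁻¹ * Torus.divergence (fun x => (totalEnergyDensity (ρ (s / m) x) (u (s / m) x)
          (θ (s / m) x) + hsPressure σ (ρ (s / m) x) (θ (s / m) x)) • u (s / m) x)
          (zoomPt x₀ m y) :=
      divergence_zoom hm hma (G := fun x => (totalEnergyDensity (ρ (s / m) x) (u (s / m) x)
          (θ (s / m) x) + hsPressure σ (ρ (s / m) x) (θ (s / m) x)) • u (s / m) x)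
        (c := (totalEnergyDensity ρbar ubar θbar + hsPressure σ ρbar θbar) • ubar)
        (fun x hx => by rw [hρ _ ht x hx, hu _ ht x hx, hθ _ ht x hx]) y
    rw [e1, e2, smul_eq_mul, ← mul_add, hE.energy _ ht _, mul_zero]

/-- The zoomed fields keep the constant state outside `{d(·, x₀) < m a}` (**(Z2)**, support). -/
theorem zoom_const_of_le (hm : 1 < m)
    (hsupp : ∀ t ∈ Ico 0 T, ∀ x, a ≤ Torus.euclidDist x x₀ →
      ρ t x = ρbar ∧ θ t x = θbar ∧ u t x = ubar)
    {s : ℝ} (hs : s ∈ Ico 0 (m * T)) {y : T3} (hy : m * a ≤ Torus.euclidDist y x₀) :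
    ρ (s / m) (zoomPt x₀ m y) = ρbar ∧ θ (s / m) (zoomPt x₀ m y) = θbar ∧
      u (s / m) (zoomPt x₀ m y) = ubar :=
  hsupp _ (div_mem_Ico (zero_lt_one.trans hm) hs) _
    (by rw [euclidDist_zoomPt hm, le_inv_mul_iff₀ (zero_lt_one.trans hm)]; exact hy)

/-- The time-`0` slice of a zoomed field is the zoom of the time-`0` slice. -/
theorem zoom_slice_zero {Y : Type*} (φ : ℝ → T3 → Y) (m : ℝ) (x₀ : T3) :
    (fun s y => φ (s / m) (zoomPt x₀ m y)) 0 = fun y => φ 0 (zoomPt x₀ m y) := by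
  funext y
  simp only [zero_div]

/-- **(Z1) + (Z2), packaged** (registered helper of `stub_bubble`): zoom covariance of
`IsHardSphereEulerSolution` under `(s, y) ↦ (s/m, zoomPt x₀ m y)` with horizon `mT`, and the
support clause of the zoomed solution. -/
theorem hsEuler_zoom : ∀ {σ T : ℝ} {ρ θ : ℝ → T3 → ℝ} {u : ℝ → T3 → V3} {m a : ℝ} {x₀ : T3}
    {ρbar θbar : ℝ} {ubar : V3}, IsHardSphereEulerSolution σ T ρ u θ → 1 < m → m * a < 1 / 4 →
    (∀ t ∈ Set.Ico 0 T, ∀ x, a ≤ Torus.euclidDist x x₀ →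
      ρ t x = ρbar ∧ θ t x = θbar ∧ u t x = ubar) →
    IsHardSphereEulerSolution σ (m * T) (fun s y => ρ (s / m) (zoomPt x₀ m y))
      (fun s y => u (s / m) (zoomPt x₀ m y)) (fun s y => θ (s / m) (zoomPt x₀ m y)) ∧
    (∀ s ∈ Set.Ico 0 (m * T), ∀ y, m * a ≤ Torus.euclidDist y x₀ →
      ρ (s / m) (zoomPt x₀ m y) = ρbar ∧ θ (s / m) (zoomPt x₀ m y) = θbar ∧
        u (s / m) (zoomPt x₀ m y) = ubar) :=
  fun hE hm hma hsupp => ⟨isHardSphereEulerSolution_zoom hE hm hma hsupp,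
    fun _ hs _ hy => zoom_const_of_le hm hsupp hs hy⟩

end Euler

end Summit.AtomisticToContinuum.HydrodynamicLimit.Theorems.ConeLocalisation.Bubble

end
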